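import Literature.AlgebraicGeometry.HodgeTheory.ComplexTorusIntegralHodgeClassesProjectionFibreIntegral
import Literature.AlgebraicGeometry.HodgeTheory.ComplexTorusIntegralHodgeClassesCorrespondenceFunctoriality
import Literature.AlgebraicGeometry.HodgeTheory.ComplexTorusIntegralHodgeClassesCorrespondenceTranspose
import Literature.Geometry.Kaehler.ComplexTorusSubtorusQuotientCohomology
import Literature.Geometry.Kaehler.ComplexTorusHodgeClassesMaps
import HarnessLib

/-!
# The push-forward along the FIRST projection: `p_{1*} = p_{2*} ∘ τ_*` is integration along the second factor; base change along the base

The companion of g27-#12 (`ComplexTorusIntegralHodgeClassesProjectionFibreIntegral`: `p_{2*} w = ∫_{X₁} w` and `p'_{2*}((1 × f)^* w) = f^*(p_{2*} w)`) for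
the first projection `p₁ : X₁ × X₂ → X₁` of a product of complex tori, on the integral Hodge classes `Hdg•(−, ℤ)` (push-forward of g27-#2):

* `realRep_swapHom` — the analytic representation of the exchange morphism `τ : X × Y → Y × X` is `(x, y) ↦ (y, x)`;
* **`integralHodgeClassesPushforward_fstHom_eq_sndHom_swapHom`** — `p_{1*} = p_{2*} ∘ τ_*` (`p₁ = τ ≫ p₂`);
* **`coe_integralHodgeClassesPushforward_fstHom`** — the form of `p_{1*} w` is the fibre integral `∫_{X₂}` (`pushforwardFst` of Layer A) of the form of `w`
  with the factors exchanged;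
* **`integralHodgeClassesPushforward_fstHom_pullbackHom_prodMap_id`** — base change along the base for `p₁`: `p'_{1*}((f × 1_{X₂})^* w) = f^*(p_{1*} w)` for EVERY
  homomorphism `f : X₁′ → X₁` (Birkenhake–Lange Thm. 6.2.5; Fulton Prop. 1.7), from g27-#12 by the exchange of factors.

Everything is proved; no definition and no named fact is introduced (D-0026).

## References

* [Lange2023AbelianVarietiesComplex] H. Lange, *Abelian Varieties over the Complex Numbers*, Springer (2023), §1.1.2 (p0021 L5), §6.2.1 Thm. 6.2.5
  (p0302), §6.2.2 (p0304 L11–L13: the exchange morphism `s`), §6.2.4 (6.10) (p0310 L33–L35).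
* [Arapura2012] D. Arapura, *Algebraic Geometry over the Complex Numbers*, Universitext (2012), §5.5.1 Lemma 5.5.1 (p0114 L1–L17).
* [Fulton1998] W. Fulton, *Intersection Theory*, 2nd ed., Springer (1998), §1.7 Prop. 1.7 (p0030), §16.1 (p0293 L12–L16).
-/

noncomputable section

open CategoryTheory Function

namespace Literature.AlgebraicGeometry.HodgeTheory

open Literature.AlgebraicGeometry.Motives Literature.AlgebraicGeometry.Motives.HodgeStructure
open Literature.Geometry.Kaehler Literature.Geometry.Kaehler.ComplexTorus

namespace ComplexTorusCat

/-! ## §0 The analytic representation of the exchange morphism -/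

section Swap

variable (X Y : ComplexTorusCat)

/-- **`ρ_ℝ(τ) = ((x, y) ↦ (y, x))`**: the real-analytic representation of the exchange morphism `τ = (p₂, p₁) : X × Y → Y × X` is `prodComm` (`τ = p₂ ≫ ι₁ + p₁ ≫
ι₂` and `ρ(ι₁) = inl`, `ρ(ι₂) = inr`, `ρ(p₁) = fst`, `ρ(p₂) = snd`). [cite: Lange2023AbelianVarietiesComplex, §6.2.2 (p0304 L11–L13) and §1.1.2 (p0020 L3–L7)] -/
theorem realRep_swapHom :
    realRep (prodObj X Y).toIsog.Φ (prodObj Y X).toIsog.Φ (swapHom X Y).1 =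
      (ContinuousLinearEquiv.prodComm ℝ X.toIsog.E Y.toIsog.E : X.toIsog.E × Y.toIsog.E →L[ℝ] Y.toIsog.E × X.toIsog.E) := by
  have h1 : realRep Y.toIsog.Φ (prodObj Y X).toIsog.Φ (inlHom Y X).1 = ContinuousLinearMap.inl ℝ Y.toIsog.E X.toIsog.E :=
    realRep_inlMatrix Y.toIsog.Φ X.toIsog.Φ
  have h2 : realRep X.toIsog.Φ (prodObj Y X).toIsog.Φ (inrHom Y X).1 = ContinuousLinearMap.inr ℝ Y.toIsog.E X.toIsog.E :=
    realRep_inrMatrix Y.toIsog.Φ X.toIsog.Φ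
  rw [swapHom_def, liftHom_def, add_val, comp_val, comp_val, realRep_add, ← realRep_mul (prodObj X Y).toIsog.Φ Y.toIsog.Φ (prodObj Y X).toIsog.Φ (inlHom Y X).1 (sndHom X Y).1,
    ← realRep_mul (prodObj X Y).toIsog.Φ X.toIsog.Φ (prodObj Y X).toIsog.Φ (inrHom Y X).1 (fstHom X Y).1, h1, h2, realRep_sndHom, realRep_fstHom]
  refine ContinuousLinearMap.ext fun u ↦ Prod.ext ?_ ?_ <;> simp

end Swap

/-! ## §1 `p_{1*} = p_{2*} ∘ τ_*` and the fibre integral along the second factor -/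

section Fst

variable {X₁ X₂ : ComplexTorusCat} {n a a' l₀ G g₁ : ℕ} (e : Fin n ≃ (prodObj X₁ X₂).toIsog.ι) (e' : Fin n ≃ (prodObj X₂ X₁).toIsog.ι) {n₁ : ℕ}
  (e₁ : Fin n₁ ≃ X₁.toIsog.ι) (hX : l₀ + 2 * a = n) (hG : G + G = n) (hY : l₀ + 2 * a' = n₁) (hg₁ : g₁ + g₁ = n₁)

/-- **`p_{1*} = p_{2*} ∘ τ_*`**: the push-forward along the first projection `p₁ : X₁ × X₂ → X₁` is the push-forward along the second projection of `X₂ × X₁` after the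
exchange `τ_*` (`p₁ = τ ≫ p₂`, functoriality of g27-#2's push-forward). [cite: Lange2023AbelianVarietiesComplex, §6.2.2 (p0304 L11–L13)] [cite: Fulton1998, §16.1 (p0293 L12–L16)] -/
theorem integralHodgeClassesPushforward_fstHom_eq_sndHom_swapHom (w : integralHodgeClasses (prodObj X₁ X₂).toIsog.Φ a) :
    integralHodgeClassesPushforward a a' (fstHom X₁ X₂) e e₁ hX hG hY hg₁ w =
      integralHodgeClassesPushforward a a' (sndHom X₂ X₁) e' e₁ hX hG hY hg₁ (integralHodgeClassesPushforward a a (swapHom X₁ X₂) e e' hX hG hX hG w) := by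
  rw [← integralHodgeClassesPushforward_comp, swapHom_sndHom]

end Fst

section FibreIntegral

variable {X₁ X₂ : ComplexTorusCat} {n₁ g₁ g₂ G a a' l₀ : ℕ} (e₁ : Fin n₁ ≃ X₁.toIsog.ι) (e₂ : Fin (2 * g₂) ≃ X₂.toIsog.ι)
  (hX : l₀ + 2 * a = n₁ + 2 * g₂) (hG : G + G = n₁ + 2 * g₂) (hY : l₀ + 2 * a' = n₁) (hg₁ : g₁ + g₁ = n₁) (haa' : 2 * a = 2 * g₂ + 2 * a')

/-- Reindexing commutes with pull-back of forms (bookkeeping). [folklore] -/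
private theorem domDomCongr_finCongr_compContinuousLinearMap₈ {V W : Type*} [NormedAddCommGroup V] [NormedSpace ℝ V] [NormedAddCommGroup W]
    [NormedSpace ℝ W] {k k' : ℕ} (h : k = k') (η : V [⋀^Fin k]→L[ℝ] ℂ) (L : W →L[ℝ] V) :
    (η.compContinuousLinearMap L).domDomCongr (finCongr h) = (η.domDomCongr (finCongr h)).compContinuousLinearMap L := by
  subst h; rfl

/-- **THE PUSH-FORWARD ALONG `p₁ : X₁ × X₂ → X₁` IS INTEGRATION ALONG THE SECOND FACTOR**: for `w ∈ Hdgᵃ(X₁ × X₂, ℤ)` (frame `e₁ ⊔ e₂`), the form of `p_{1*} w ∈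
Hdg^{a − g₂}(X₁, ℤ)` is `pushforwardFst` (the fibre integral of Layer A, fibre `X₂` in FIRST position) of the form of `w` with the factors exchanged, `w ∘ ((y, x) ↦ (x,
y))` — g27-#12's `p_{2*} = ∫` after `p_{1*} = p_{2*} τ_*`, `τ_* = τ'^*` (g27-#6) and `ρ(τ') = prodComm` (§0). [cite: Arapura2012, §5.5.1 Lemma 5.5.1 (p0114 L1–L17)]
[cite: Lange2023AbelianVarietiesComplex, §6.2.4 (6.10) (p0310 L33–L35)] -/
theorem coe_integralHodgeClassesPushforward_fstHom (w : integralHodgeClasses (prodObj X₁ X₂).toIsog.Φ a) :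
    ((integralHodgeClassesPushforward a a' (fstHom X₁ X₂) (sumEnum e₁ e₂) e₁ hX hG hY hg₁ w : integralHodgeClasses X₁.toIsog.Φ a') :
        X₁.toIsog.E [⋀^Fin (2 * a')]→L[ℝ] ℂ) =
      pushforwardFst X₂.toIsog.Φ X₁.toIsog.Φ e₂
        (((w : (X₁.toIsog.E × X₂.toIsog.E) [⋀^Fin (2 * a)]→L[ℝ] ℂ).compContinuousLinearMap
          (ContinuousLinearEquiv.prodComm ℝ X₂.toIsog.E X₁.toIsog.E : X₂.toIsog.E × X₁.toIsog.E →L[ℝ] X₁.toIsog.E × X₂.toIsog.E)).domDomCongr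
            (finCongr haa')) := by
  rw [integralHodgeClassesPushforward_fstHom_eq_sndHom_swapHom (sumEnum e₁ e₂) ((sumEnum e₁ e₂).trans (Equiv.sumComm _ _)) e₁ hX hG hY hg₁,
    integralHodgeClassesPushforward_eq_of_enum' a a' (sndHom X₂ X₁) (Nat.add_comm n₁ (2 * g₂)) rfl ((sumEnum e₁ e₂).trans (Equiv.sumComm _ _)) (sumEnum e₂ e₁) e₁ e₁
      hX hG hY hg₁ (show l₀ + 2 * a = 2 * g₂ + n₁ by omega) (show G + G = 2 * g₂ + n₁ by omega) hY hg₁,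
    coe_integralHodgeClassesPushforward_sndHom e₂ e₁ (show l₀ + 2 * a = 2 * g₂ + n₁ by omega) (show G + G = 2 * g₂ + n₁ by omega) hY hg₁ haa',
    integralHodgeClassesPushforward_swapHom X₁ X₂ (sumEnum e₁ e₂) ((sumEnum e₁ e₂).trans (Equiv.sumComm _ _)) hX hG, coe_integralHodgeClassesPullbackHom_apply,
    realRep_swapHom, domDomCongr_finCongr_compContinuousLinearMap₈]

end FibreIntegral

/-! ## §2 Base change along the base for `p₁`: `p'_{1*}((f × 1)^* w) = f^*(p_{1*} w)` for EVERY homomorphism `f` -/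

section BaseChange

variable {X₁ X₁' X₂ : ComplexTorusCat} (f : X₁' ⟶ X₁) {n₁ n₁' g₂ g₁ g₁' G G' a a' l₀ l₀' : ℕ} (e₁ : Fin n₁ ≃ X₁.toIsog.ι) (e₁' : Fin n₁' ≃ X₁'.toIsog.ι)
  (e₂ : Fin (2 * g₂) ≃ X₂.toIsog.ι) (hX : l₀ + 2 * a = n₁ + 2 * g₂) (hG : G + G = n₁ + 2 * g₂) (hY : l₀ + 2 * a' = n₁) (hg₁ : g₁ + g₁ = n₁)
  (hX' : l₀' + 2 * a = n₁' + 2 * g₂) (hG' : G' + G' = n₁' + 2 * g₂) (hY' : l₀' + 2 * a' = n₁') (hg₁' : g₁' + g₁' = n₁')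

/-- **BASE CHANGE ALONG THE BASE FOR THE FIRST PROJECTION: `p'_{1*}((f × 1_{X₂})^* w) = f^*(p_{1*} w)`** in `Hdg•(X₁′, ℤ)`, for EVERY homomorphism `f : X₁′ → X₁` of complex
tori and `w ∈ Hdgᵃ(X₁ × X₂, ℤ)` (the square `X₁′ × X₂ → X₁ × X₂`, `X₁′ → X₁`; Birkenhake–Lange Thm. 6.2.5, Fulton Prop. 1.7) — g27-#12's statement for `p₂` transported
along the exchange: `p₁ = τ p₂`, `τ_* = τ'^*`, `(1 × f) ≫ τ = τ ≫ (f × 1)`. Frames `e₁ ⊔ e₂`, `e₁′ ⊔ e₂`. [cite: Lange2023AbelianVarietiesComplex, §6.2.1 Thm. 6.2.5 (p0302)]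
[cite: Fulton1998, §1.7 Prop. 1.7 (p0030)] -/
theorem integralHodgeClassesPushforward_fstHom_pullbackHom_prodMap_id (w : integralHodgeClasses (prodObj X₁ X₂).toIsog.Φ a) :
    integralHodgeClassesPushforward a a' (fstHom X₁' X₂) (sumEnum e₁' e₂) e₁' hX' hG' hY' hg₁' (integralHodgeClassesPullbackHom (prodMap f (𝟙 X₂)) a w) =
      integralHodgeClassesPullbackHom f a' (integralHodgeClassesPushforward a a' (fstHom X₁ X₂) (sumEnum e₁ e₂) e₁ hX hG hY hg₁ w) := by
  rw [integralHodgeClassesPushforward_fstHom_eq_sndHom_swapHom (sumEnum e₁' e₂) ((sumEnum e₁' e₂).trans (Equiv.sumComm _ _)) e₁' hX' hG' hY' hg₁',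
    integralHodgeClassesPushforward_fstHom_eq_sndHom_swapHom (sumEnum e₁ e₂) ((sumEnum e₁ e₂).trans (Equiv.sumComm _ _)) e₁ hX hG hY hg₁,
    integralHodgeClassesPushforward_swapHom X₁' X₂ (sumEnum e₁' e₂) ((sumEnum e₁' e₂).trans (Equiv.sumComm _ _)) hX' hG',
    integralHodgeClassesPushforward_swapHom X₁ X₂ (sumEnum e₁ e₂) ((sumEnum e₁ e₂).trans (Equiv.sumComm _ _)) hX hG,
    ← integralHodgeClassesPullbackHom_comp, ← prodMap_swapHom, integralHodgeClassesPullbackHom_comp,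
    integralHodgeClassesPushforward_eq_of_enum' a a' (sndHom X₂ X₁') (Nat.add_comm n₁' (2 * g₂)) rfl ((sumEnum e₁' e₂).trans (Equiv.sumComm _ _)) (sumEnum e₂ e₁')
      e₁' e₁' hX' hG' hY' hg₁' (show l₀' + 2 * a = 2 * g₂ + n₁' by omega) (show G' + G' = 2 * g₂ + n₁' by omega) hY' hg₁',
    integralHodgeClassesPushforward_eq_of_enum' a a' (sndHom X₂ X₁) (Nat.add_comm n₁ (2 * g₂)) rfl ((sumEnum e₁ e₂).trans (Equiv.sumComm _ _)) (sumEnum e₂ e₁)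
      e₁ e₁ hX hG hY hg₁ (show l₀ + 2 * a = 2 * g₂ + n₁ by omega) (show G + G = 2 * g₂ + n₁ by omega) hY hg₁,
    integralHodgeClassesPushforward_sndHom_pullbackHom_prodMap_id f e₂ e₁ e₁' (show l₀ + 2 * a = 2 * g₂ + n₁ by omega) (show G + G = 2 * g₂ + n₁ by omega) hY hg₁
      (show l₀' + 2 * a = 2 * g₂ + n₁' by omega) (show G' + G' = 2 * g₂ + n₁' by omega) hY' hg₁']

end BaseChange

end ComplexTorusCat

end Literature.AlgebraicGeometry.HodgeTheory
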